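import Literature.NumberTheory.PAdicHodge.BmaxPlusTRegular
import Literature.NumberTheory.PAdicHodge.BdRPlusDVR
import Mathlib.RingTheory.AdicCompletion.LocalRing
import HarnessLib

/-!
# `t = ([ε] − 1)·v` with `v` a unit of `A_max` (`p` odd), and the Frobenius of `v`

Topic `Literature/NumberTheory/PAdicHodge`; namespace `Literature.NumberTheory.PAdicHodge`. THEOREMS ONLY (no definition, no named
fact, no instance). Continuation of `BmaxPlusLog` / `BmaxPlusTRegular` on Colmez's `A_max = B_max⁺(F)` (`BmaxPlus`): Fontaine's
`t = log[ε] = Σ_{k≥1} (−1)^{k+1} u^k/k` (`u = [ε] − 1 = uAinf`, `tBmax`) factors as `t = u·v` with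
`v = Σ_{k≥1} (−1)^{k+1} u^{k−1}/k = 1 − u/2 + u²/3 − ⋯`; since `u^{k−1}/k = (p^{k−1}/k)·(w·ξ/p)^{k−1}` (`w = u/ξ = uDivXi`) and
`p^{k−1}/k ∈ pℤ_p` for `k ≥ 2` when `p` is odd, `v ≡ 1 (mod p·A_max)` is a unit.

* `algebraMap_uAinf_mul_vSum` — the partial sums `V_N = Σ_{j<N} (−1)^j d_{j+1} w^j (ξ/p)^j` (`(j+1)·d_{j+1} = p^j`) satisfy `u·V_N = logSum N`;
* ★ `exists_isUnit_tBmax_eq_uAinf_mul` — **for `p ≠ 2` there is a unit `v ∈ A_maxˣ` with `t = ι(u)·v`** (so `t·A_max = u·A_max`);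
* `frobenius_uAinf_eq_mul_frobenius_omega` — `φ(u) = u·φ(ω)` (`ω = 1 + [ε^{1/p}] + ⋯`, `u = ([ε^{1/p}] − 1)ω`);
* ★ `frobenius_omega_mul_frobBmaxPlus_eq_of_tBmax_eq` — **`ι(φω)·φ(v) = p·v`** for any `v` with `t = ι(u)·v` (from `φt = pt`; `ι(u)` is a
  non-zero-divisor on `A_max`).

Step (TU) of the `t`-divisibility theorem (TDIV) for `(A_max)^{φ=p} ∩ ker θ` (brick B7 of the φ-road of line `kato_lever`,
crux K★ `stmt-BirchSwinnertonDyer-22226`, memo `Cruxes/StarredOptimalManinUnitFiveSeven/Lines/kato-lever-K2-fontaine-lemma-g24.md` §1: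
"`t = u·v` with `v ∈ 1 + pA` a UNIT of `A` (`p` odd)"). Infrastructure only: BSD / K★ are not proved by any of this.

## References
* [FontaineAsterisque223III] J.-M. Fontaine, *Le corps des périodes p-adiques*, Astérisque 223 (1994), Exp. II §1.5.4, Exp. III §5.2
  (`t` and `[ε] − 1` differ by a unit of `A_cris`).
* [Colmez1998Annals] P. Colmez, *Théorie d'Iwasawa des représentations de de Rham d'un corps local*, Ann. of Math. 148 (1998), §III.2–III.3.
-/

noncomputable section

open WittVector Field ValuativeRel Polynomial Finset
open Literature.AlgebraicGeometry.Resolution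

namespace Literature.NumberTheory.PAdicHodge

open Literature.NumberTheory.GaloisRepresentations
open Literature.NumberTheory.GaloisRepresentations.IsNonarchimedeanLocalField

variable {F : Type} [Field F] [ValuativeRel F] [TopologicalSpace F] [IsNonarchimedeanLocalField F]
  [CharZero F] {p : ℕ} [Fact p.Prime] [Fact (¬ IsUnit (p : integerC F))]
  [IsAdicComplete (Ideal.span {(p : integerC F)}) (integerC F)]

/-! ### The coefficients `d_k = p^{k−1}/k ∈ ℤ_p` -/

/-- **`k·d = p^{k−1}` is solvable in `ℤ_p` for every `k ≥ 1`** (`v_p(k) ≤ k − 1`). [cite: FontaineAsterisque223III, Exp. II §1.5.4] -/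
theorem exists_natCast_mul_eq_pow_sub_one :
    ∃ d : ℕ → ℤ_[p], ∀ k : ℕ, k ≠ 0 → (k : ℤ_[p]) * d k = (p : ℤ_[p]) ^ (k - 1) := by
  have h : ∀ k : ℕ, ∃ d : ℤ_[p], k ≠ 0 → (k : ℤ_[p]) * d = (p : ℤ_[p]) ^ (k - 1) := by
    intro k
    by_cases hk : k = 0
    · exact ⟨0, fun h => absurd hk h⟩
    · have hv : k.factorization p ≤ k - 1 := by have := two_mul_factorization_le (p := p) k; omega
      obtain ⟨d, hd⟩ := exists_natCast_mul_eq_pow hk hv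
      exact ⟨d, fun _ => hd⟩
  choose d hd using h
  exact ⟨d, hd⟩

/-- `p · d_k = c_k = p^k/k` (`logCoeff`). [cite: FontaineAsterisque223III, Exp. II §1.5.4] -/
theorem natCast_mul_eq_logCoeff {d : ℕ → ℤ_[p]} (hd : ∀ k : ℕ, k ≠ 0 → (k : ℤ_[p]) * d k = (p : ℤ_[p]) ^ (k - 1)) {k : ℕ} (hk : k ≠ 0) :
    (p : ℤ_[p]) * d k = logCoeff p k := by
  refine mul_left_cancel₀ (Nat.cast_ne_zero.2 hk : (k : ℤ_[p]) ≠ 0) ?_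
  rw [natCast_mul_logCoeff hk, mul_left_comm, hd k hk, ← pow_succ', Nat.sub_add_cancel (Nat.one_le_iff_ne_zero.2 hk)]

/-- `d_1 = 1`. [cite: FontaineAsterisque223III, Exp. II §1.5.4] -/
theorem d_one_eq_one {d : ℕ → ℤ_[p]} (hd : ∀ k : ℕ, k ≠ 0 → (k : ℤ_[p]) * d k = (p : ℤ_[p]) ^ (k - 1)) : d 1 = 1 := by
  have h := hd 1 one_ne_zero
  rwa [Nat.cast_one, one_mul, Nat.sub_self, pow_zero] at h

/-- **`d_k ∈ p^m ℤ_p` for `2(m+1) ≤ k`** (from `c_k ∈ p^{m+1}ℤ_p`). [cite: FontaineAsterisque223III, Exp. II §1.5.4] -/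
theorem exists_d_eq_pow_mul {d : ℕ → ℤ_[p]} (hd : ∀ k : ℕ, k ≠ 0 → (k : ℤ_[p]) * d k = (p : ℤ_[p]) ^ (k - 1)) {k m : ℕ} (hk : k ≠ 0)
    (h : 2 * (m + 1) ≤ k) : ∃ e : ℤ_[p], d k = (p : ℤ_[p]) ^ m * e := by
  obtain ⟨e, he⟩ := exists_logCoeff_eq_pow_mul (p := p) hk h
  refine ⟨e, mul_left_cancel₀ (Nat.cast_ne_zero.2 (Fact.out : p.Prime).ne_zero : (p : ℤ_[p]) ≠ 0) ?_⟩
  rw [natCast_mul_eq_logCoeff hd hk, he, pow_succ]; ring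

/-- **`d_k ∈ pℤ_p` for `k ≥ 2` when `p` is odd** (`v_p(k) ≤ k − 2`). [cite: FontaineAsterisque223III, Exp. III §5.2] -/
theorem exists_d_eq_p_mul (hp : p ≠ 2) {d : ℕ → ℤ_[p]} (hd : ∀ k : ℕ, k ≠ 0 → (k : ℤ_[p]) * d k = (p : ℤ_[p]) ^ (k - 1)) {k : ℕ}
    (hk : 2 ≤ k) : ∃ e : ℤ_[p], d k = (p : ℤ_[p]) * e := by
  have hk0 : k ≠ 0 := by omega
  have hv : k.factorization p ≤ k - 2 := by
    rcases Nat.lt_or_ge k 3 with h3 | h3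
    · have hk2 : k = 2 := by omega
      subst hk2
      have h2 : ¬ p ∣ 2 := fun h => hp ((Nat.prime_dvd_prime_iff_eq Fact.out Nat.prime_two).1 h)
      rw [Nat.factorization_eq_zero_of_not_dvd h2]
    · have := two_mul_factorization_le (p := p) k; omega
  obtain ⟨e, he⟩ := exists_natCast_mul_eq_pow hk0 hv
  refine ⟨e, mul_left_cancel₀ (Nat.cast_ne_zero.2 hk0 : (k : ℤ_[p]) ≠ 0) ?_⟩
  rw [hd k hk0, mul_left_comm, he, ← pow_succ', show k - 2 + 1 = k - 1 by omega]

/-! ### The partial sums `V_N` with `u · V_N = logSum N` -/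

/-- **`u · (−1)^j d_{j+1} w^j (ξ/p)^j = logTerm (j+1)`** (`u = ξ·w = p·(ξ/p)·w`, `p·d_{j+1} = c_{j+1}`). [cite: FontaineAsterisque223III, Exp. II §1.5.4] -/
theorem algebraMap_uAinf_mul_vTerm {d : ℕ → ℤ_[p]} (hd : ∀ k : ℕ, k ≠ 0 → (k : ℤ_[p]) * d k = (p : ℤ_[p]) ^ (k - 1)) (j : ℕ) :
    algebraMap (Ainf (p := p) F) (bmaxZero F p) uAinf *
        ((-1) ^ j * algebraMap (Ainf (p := p) F) (bmaxZero F p) (zpToAinf (d (j + 1)) * uDivXi ^ j) * omegaB ^ j) =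
      logTerm (j + 1) := by
  have h1 : zpToAinf (logCoeff p (j + 1)) = (p : Ainf (p := p) F) * zpToAinf (d (j + 1)) := by
    rw [← natCast_mul_eq_logCoeff hd (Nat.succ_ne_zero j), map_mul, map_natCast]
  rw [logTerm, h1, ← xi_mul_uDivXi]
  simp only [map_mul, map_natCast, map_pow, ← natCast_mul_omegaB, pow_succ]
  ring

/-- **`u · V_N = logSum N`** for `V_N = Σ_{j<N} (−1)^j d_{j+1} w^j (ξ/p)^j`. [cite: FontaineAsterisque223III, Exp. II §1.5.4] -/
theorem algebraMap_uAinf_mul_vSum {d : ℕ → ℤ_[p]} (hd : ∀ k : ℕ, k ≠ 0 → (k : ℤ_[p]) * d k = (p : ℤ_[p]) ^ (k - 1)) (N : ℕ) :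
    algebraMap (Ainf (p := p) F) (bmaxZero F p) uAinf *
        (∑ j ∈ range N, (-1) ^ j * algebraMap (Ainf (p := p) F) (bmaxZero F p) (zpToAinf (d (j + 1)) * uDivXi ^ j) * omegaB ^ j) =
      logSum N := by
  rw [logSum, mul_sum]
  exact sum_congr rfl fun j _ => algebraMap_uAinf_mul_vTerm hd j

/-- The `j`-th term lies in `p^m B⁰_max` once `2(m+1) ≤ j+1`. [cite: FontaineAsterisque223III, Exp. II §1.5.4] -/
theorem vTerm_mem_span_pow {d : ℕ → ℤ_[p]} (hd : ∀ k : ℕ, k ≠ 0 → (k : ℤ_[p]) * d k = (p : ℤ_[p]) ^ (k - 1)) {j m : ℕ}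
    (h : 2 * (m + 1) ≤ j + 1) :
    (-1) ^ j * algebraMap (Ainf (p := p) F) (bmaxZero F p) (zpToAinf (d (j + 1)) * uDivXi ^ j) * omegaB ^ j ∈
      Ideal.span {(p : bmaxZero F p)} ^ m := by
  obtain ⟨e, he⟩ := exists_d_eq_pow_mul hd (Nat.succ_ne_zero j) h
  rw [Ideal.span_singleton_pow, Ideal.mem_span_singleton']
  refine ⟨(-1) ^ j * algebraMap (Ainf (p := p) F) (bmaxZero F p) (zpToAinf e * uDivXi ^ j) * omegaB ^ j, ?_⟩
  rw [he, map_mul zpToAinf, map_pow zpToAinf, map_natCast]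
  simp only [map_mul, map_pow, map_natCast]
  ring

/-- **Tail estimate**: `V_N − V_M ∈ p^m B⁰_max` for `M ≤ N` and `2(m+1) ≤ M + 1`. [cite: FontaineAsterisque223III, Exp. II §1.5.4] -/
theorem vSum_sub_vSum_mem {d : ℕ → ℤ_[p]} (hd : ∀ k : ℕ, k ≠ 0 → (k : ℤ_[p]) * d k = (p : ℤ_[p]) ^ (k - 1)) {M N m : ℕ}
    (hMN : M ≤ N) (hM : 2 * (m + 1) ≤ M + 1) :
    (∑ j ∈ range N, (-1) ^ j * algebraMap (Ainf (p := p) F) (bmaxZero F p) (zpToAinf (d (j + 1)) * uDivXi ^ j) * omegaB ^ j) -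
        (∑ j ∈ range M, (-1) ^ j * algebraMap (Ainf (p := p) F) (bmaxZero F p) (zpToAinf (d (j + 1)) * uDivXi ^ j) * omegaB ^ j) ∈
      Ideal.span {(p : bmaxZero F p)} ^ m := by
  rw [← sum_Ico_eq_sub _ hMN]
  exact Ideal.sum_mem _ fun j hj => vTerm_mem_span_pow hd (by have := (mem_Ico.1 hj).1; omega)

/-- **The sums `n ↦ V_{p^{n+1} − 1}` are `p`-adically Cauchy** (`2(n+1) ≤ p^{n+1}`). [cite: FontaineAsterisque223III, Exp. II §1.5.4] -/
theorem isAdicCauchy_vSum {d : ℕ → ℤ_[p]} (hd : ∀ k : ℕ, k ≠ 0 → (k : ℤ_[p]) * d k = (p : ℤ_[p]) ^ (k - 1)) :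
    AdicCompletion.IsAdicCauchy (Ideal.span {(p : bmaxZero F p)}) (bmaxZero F p) fun n =>
      ∑ j ∈ range (p ^ (n + 1) - 1), (-1) ^ j * algebraMap (Ainf (p := p) F) (bmaxZero F p) (zpToAinf (d (j + 1)) * uDivXi ^ j) * omegaB ^ j := by
  intro m n hmn
  rw [SModEq.sub_mem, smul_eq_mul, Ideal.mul_top, ← neg_sub]
  refine neg_mem (vSum_sub_vSum_mem hd ?_ ?_)
  · exact Nat.sub_le_sub_right (Nat.pow_le_pow_right (Nat.Prime.pos Fact.out) (by omega)) 1
  · rw [Nat.sub_add_cancel (Nat.one_le_pow _ _ (Nat.Prime.pos Fact.out))]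
    exact two_mul_le_prime_pow (m + 1)

/-! ### `t = u · v` -/

set_option maxHeartbeats 1600000 in
set_option synthInstance.maxHeartbeats 400000 in
/-- **`t = ι(u)·v`** for any `v ∈ A_max` whose level-`n` classes are those of `V_{p^{n+1}−1}` (e.g. the `p`-adic limit of the `V_{p^{n+1}−1}`).
[cite: FontaineAsterisque223III, Exp. II §1.5.4] -/
theorem tBmax_eq_uAinf_mul_of_evalₐ_eq {d : ℕ → ℤ_[p]} (hd : ∀ k : ℕ, k ≠ 0 → (k : ℤ_[p]) * d k = (p : ℤ_[p]) ^ (k - 1))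
    {v : BmaxPlus F p} (hv : ∀ n, AdicCompletion.evalₐ (Ideal.span {(p : bmaxZero F p)}) n v =
      Ideal.Quotient.mk _ (∑ j ∈ range (p ^ (n + 1) - 1),
        (-1) ^ j * algebraMap (Ainf (p := p) F) (bmaxZero F p) (zpToAinf (d (j + 1)) * uDivXi ^ j) * omegaB ^ j)) :
    tBmax (F := F) (p := p) = ainfToBmaxPlus F p uAinf * v := by
  refine AdicCompletion.ext_evalₐ fun n => ?_
  have e2 : AdicCompletion.evalₐ (Ideal.span {(p : bmaxZero F p)}) n (ainfToBmaxPlus F p uAinf * v) =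
      AdicCompletion.evalₐ (Ideal.span {(p : bmaxZero F p)}) n (ainfToBmaxPlus F p uAinf) *
        AdicCompletion.evalₐ (Ideal.span {(p : bmaxZero F p)}) n v := map_mul _ _ _
  rw [e2, evalₐ_ainfToBmaxPlus, hv n, ← map_mul, algebraMap_uAinf_mul_vSum hd, evalₐ_tBmax, Ideal.Quotient.mk_eq_mk_iff_sub_mem,
    ← neg_sub]
  refine neg_mem (logSum_sub_logSum_mem ?_ ?_)
  · exact Nat.sub_le_sub_right (Nat.pow_le_pow_right (Nat.Prime.pos Fact.out) (Nat.le_succ n)) 1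
  · rw [Nat.sub_add_cancel (Nat.one_le_pow _ _ (Nat.Prime.pos Fact.out))]
    exact two_mul_le_prime_pow n

/-! ### `v` is a unit when `p` is odd -/

set_option maxHeartbeats 1600000 in
/-- **`V_N ≡ 1 (mod p·B⁰_max)`** for `N ≥ 1` and `p` odd (`d_1 = 1`, `d_k ∈ pℤ_p` for `k ≥ 2`). [cite: FontaineAsterisque223III, Exp. III §5.2] -/
theorem vSum_sub_one_mem_span (hp : p ≠ 2) {d : ℕ → ℤ_[p]} (hd : ∀ k : ℕ, k ≠ 0 → (k : ℤ_[p]) * d k = (p : ℤ_[p]) ^ (k - 1))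
    {N : ℕ} (hN : 1 ≤ N) :
    (∑ j ∈ range N, (-1) ^ j * algebraMap (Ainf (p := p) F) (bmaxZero F p) (zpToAinf (d (j + 1)) * uDivXi ^ j) * omegaB ^ j) - 1 ∈
      Ideal.span {(p : bmaxZero F p)} := by
  obtain ⟨N, rfl⟩ := Nat.exists_eq_add_of_le' hN
  rw [sum_range_succ', pow_zero, pow_zero, pow_zero, one_mul, mul_one, mul_one, zero_add, d_one_eq_one hd, map_one, map_one,
    add_sub_cancel_right]
  refine Ideal.sum_mem _ fun j _ => ?_
  obtain ⟨e, he⟩ := exists_d_eq_p_mul hp hd (k := j + 1 + 1) (by omega)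
  rw [he, Ideal.mem_span_singleton']
  refine ⟨(-1) ^ (j + 1) * algebraMap (Ainf (p := p) F) (bmaxZero F p) (zpToAinf e * uDivXi ^ (j + 1)) * omegaB ^ (j + 1), ?_⟩
  simp only [map_mul, map_natCast, map_pow]
  ring

set_option maxHeartbeats 1600000 in
set_option synthInstance.maxHeartbeats 400000 in
/-- ★ **`t = ι([ε] − 1)·v` with `v` a UNIT of `A_max`, for `p` odd**: `v = 1 − u/2 + u²/3 − ⋯ ≡ 1 (mod p·A_max)` and `p` lies in the
Jacobson radical of the `p`-adically complete ring `A_max`. Hence `t·A_max = ([ε] − 1)·A_max`.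
[cite: FontaineAsterisque223III, Exp. III §5.2] [cite: Colmez1998Annals, §III.3] -/
theorem exists_isUnit_tBmax_eq_uAinf_mul (hp : p ≠ 2) :
    ∃ v : BmaxPlus F p, IsUnit v ∧ tBmax (F := F) (p := p) = ainfToBmaxPlus F p uAinf * v := by
  obtain ⟨d, hd⟩ := exists_natCast_mul_eq_pow_sub_one (p := p)
  obtain ⟨v, hv⟩ : ∃ v : BmaxPlus F p, ∀ n, AdicCompletion.evalₐ (Ideal.span {(p : bmaxZero F p)}) n v =
      Ideal.Quotient.mk _ (∑ j ∈ range (p ^ (n + 1) - 1),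
        (-1) ^ j * algebraMap (Ainf (p := p) F) (bmaxZero F p) (zpToAinf (d (j + 1)) * uDivXi ^ j) * omegaB ^ j) :=
    ⟨AdicCompletion.mk (Ideal.span {(p : bmaxZero F p)}) (bmaxZero F p) ⟨_, isAdicCauchy_vSum hd⟩, fun n => AdicCompletion.evalₐ_mk _ _ _⟩
  refine ⟨v, ?_, tBmax_eq_uAinf_mul_of_evalₐ_eq hd hv⟩
  -- `v − 1 ∈ p·A_max`
  have h1 : AdicCompletion.evalₐ (Ideal.span {(p : bmaxZero F p)}) 1 (v - 1) = 0 := by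
    rw [map_sub, map_one, hv 1, ← map_one (Ideal.Quotient.mk (Ideal.span {(p : bmaxZero F p)} ^ 1)), ← map_sub,
      Ideal.Quotient.eq_zero_iff_mem, pow_one]
    refine vSum_sub_one_mem_span hp hd ?_
    have : 2 ≤ p ^ (1 + 1) := le_trans (Nat.Prime.two_le Fact.out) (Nat.le_self_pow (by norm_num) p)
    omega
  obtain ⟨s, hs⟩ := (PrincipalCompletion.evalₐ_eq_zero_iff (I := Ideal.span {(p : bmaxZero F p)}) rfl (v - 1) 1).1 h1
  rw [pow_one] at hs
  -- `p` lies in the Jacobson radical of `A_max`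
  have hJ : PrincipalCompletion.xiHat (Ideal.span {(p : bmaxZero F p)}) (p : bmaxZero F p) * s ∈
      (⊥ : Ideal (BmaxPlus F p)).jacobson := by
    haveI := AdicCompletion.isAdicComplete_self (Ideal.span {(p : bmaxZero F p)}) (Submodule.fg_span_singleton _)
    refine IsAdicComplete.le_jacobson_bot ((Ideal.span {(p : bmaxZero F p)}).map (algebraMap (bmaxZero F p) (BmaxPlus F p))) ?_
    rw [PrincipalCompletion.map_eq_span (I := Ideal.span {(p : bmaxZero F p)}) rfl]
    exact Ideal.mul_mem_right _ _ (Ideal.mem_span_singleton_self _)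
  have h2 : IsUnit (PrincipalCompletion.xiHat (Ideal.span {(p : bmaxZero F p)}) (p : bmaxZero F p) * s * 1 + 1) :=
    Ideal.mem_jacobson_bot.1 hJ 1
  rw [mul_one] at h2
  rw [show v = PrincipalCompletion.xiHat (Ideal.span {(p : bmaxZero F p)}) (p : bmaxZero F p) * s + 1 by rw [← hs, sub_add_cancel]]
  exact h2

/-! ### The Frobenius of `v` -/

omit [IsAdicComplete (Ideal.span {(p : integerC F)}) (integerC F)] in
/-- **`φ(u) = u · φ(ω)`** (`u = ([ε^{1/p}] − 1)·ω` and `φ([ε^{1/p}] − 1) = [ε] − 1 = u`). [cite: FontaineAsterisque223III, Exp. II §1.5.4] -/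
theorem frobenius_uAinf_eq_mul_frobenius_omega :
    WittVector.frobenius (uAinf : Ainf (p := p) F) = uAinf * WittVector.frobenius omega := by
  conv_lhs => rw [uAinf_eq_mul_omega]
  rw [map_mul, map_sub, frobenius_teichmuller, ← map_pow, epsRoot_pow, map_one, ← uAinf_def]

set_option maxHeartbeats 1600000 in
omit [CharZero F] [IsAdicComplete (Ideal.span {(p : integerC F)}) (integerC F)] in
/-- `ι(ξ) = p·(ξ/p)` in `A_max`. [cite: Colmez1998Annals, §III.2] -/
theorem ainfToBmaxPlus_xi : ainfToBmaxPlus F p xi = (p : BmaxPlus F p) * algebraMap (bmaxZero F p) (BmaxPlus F p) omegaB := by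
  rw [ainfToBmaxPlus, RingHom.comp_apply, ← natCast_mul_omegaB, map_mul, map_natCast]

set_option maxHeartbeats 1600000 in
/-- **`ι(u) = ι([ε] − 1)` is a non-zero-divisor on `A_max`** (`u = ξ·w = p·(ξ/p)·w` with `θ(w) ≠ 0`). [cite: Colmez1998Annals, §III.2] -/
theorem eq_zero_of_uAinf_mul_eq_zero (hF : Function.Surjective (fontaineTheta (integerC F) p)) {z : BmaxPlus F p}
    (hz : ainfToBmaxPlus F p uAinf * z = 0) : z = 0 := by
  have h1 : ainfToBmaxPlus F p uAinf =
      (p : BmaxPlus F p) * (algebraMap (bmaxZero F p) (BmaxPlus F p) omegaB * ainfToBmaxPlus F p uDivXi) := by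
    rw [← xi_mul_uDivXi, map_mul, ainfToBmaxPlus_xi, mul_assoc]
  rw [h1, mul_assoc, mul_assoc] at hz
  have h2 := eq_zero_of_omegaB_mul_eq_zero (eq_zero_of_natCast_mul_eq_zero' hF hz)
  refine eq_zero_of_mul_eq_zero_of_thetaBmaxPlus_ne_zero hF ?_ h2
  rw [thetaBmaxPlus_ainfToBmaxPlus]
  exact fontaineTheta_uDivXi_ne_zero

set_option maxHeartbeats 1600000 in
/-- ★ **`ι(φω)·φ(v) = p·v`** for any `v ∈ A_max` with `t = ι(u)·v`: apply `φ` to `t = ι(u)v`, use `φ(t) = p·t` and `φ(u) = u·φ(ω)`, and cancel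
the non-zero-divisor `ι(u)`. (So `φ(v) = v/w₀` with `w₀ = φ(ω)/p = Φ_p([ε])/p ∈ A_maxˣ`: the factor `v` carries the zeros of `t` at the points
`θ∘φ^{−n}`, `n ≥ 1`, outside the disc `|[p♭]| ≤ |p|`.) [cite: Colmez1998Annals, §III.3] -/
theorem frobenius_omega_mul_frobBmaxPlus_eq_of_tBmax_eq (hF : Function.Surjective (fontaineTheta (integerC F) p)) {v : BmaxPlus F p}
    (hv : tBmax (F := F) (p := p) = ainfToBmaxPlus F p uAinf * v) :
    ainfToBmaxPlus F p (WittVector.frobenius omega) * frobBmaxPlus F p v = (p : BmaxPlus F p) * v := by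
  have h := frobBmaxPlus_tBmax (F := F) (p := p)
  rw [hv, map_mul, frobBmaxPlus_ainfToBmaxPlus, frobenius_uAinf_eq_mul_frobenius_omega, map_mul, map_natCast] at h
  refine sub_eq_zero.1 (eq_zero_of_uAinf_mul_eq_zero hF ?_)
  rw [mul_sub]
  linear_combination h

end Literature.NumberTheory.PAdicHodge

end
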